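import Literature.NumberTheory.Automorphic.UnitaryGroupSingularBorelClass
import Literature.NumberTheory.Automorphic.UnitaryGroupTruncatedKernelClassHyperbolic
import HarnessLib

/-!
# The two rational Borels through a regular hyperbolic element of `U(J₃)(F)`
(Rogawski, *Automorphic Representations of Unitary Groups in Three Variables* (1990), §6.1 pp. 79–81:
«Let `γ` be a regular element in `M` … `J^T_𝔬(f)` can be expressed as a weighted orbital integral …
`W(g) = (T − H(m)) − (−T + H(wmw⁻¹wn)) = 2T − H(wn)`», `w` the non-trivial element of `Ω(M)`; §3.6 (the
centraliser of a regular element of `M` is `M`); Arthur, *A trace formula for reductive groups I*, Duke Math.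
J. 45 (1978), §8: a regular («unramified») class meets `P(F)` along `{γ, γ^w}·N(F)` and each of its elements
lies in exactly the parabolics `P^δ`, `P^{wδ}`.)

Topic `NumberTheory/Automorphic`; namespace `Literature.NumberTheory.Automorphic.UnitaryGroup`. THEOREMS
ONLY over accepted tree modules: no definition, no named fact, no instance, no notation, no `sorry`. Item
(L5-ii) W2-a (first half) of the T1-qs road (LAW 5 (ii) «the weighted hyperbolic term») of
`Cruxes/H413/Lines/F0_T1InnerFormTraceIdentity.lean` (cell `pub/hodgecm-mathlib`, crux H413): the
COMBINATORIAL input of the `j`-kernel regrouping of `k^T_𝔬` for a regular hyperbolic class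
`𝔬 ∋ γ₀ = d(a, b, (ca)⁻¹)` (`c a · a ≠ 1`, `b ∈ E¹`; class (iii) of ★ `meetsBorel_trichotomy`): each
`γ′ = δ⁻¹γ₀δ ∈ 𝔬` lies in EXACTLY TWO rational Borel subgroups, `δ⁻¹Bδ` and `δ⁻¹w⁻¹Bwδ`, so the correction
term `Σ_{δ ∈ B(F)∖G(F)} 1_{T<H(δx)} K̃_{B,𝔬}(δx,δx)` of `k^T_𝔬(x)` regroups as
`Σ_{γ′ = δ⁻¹γ₀δ ∈ 𝔬} f(x⁻¹γ′x)·[1_{T<H(δx)} + 1_{T<H(wδx)}]`, producing Arthur's weight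
`u_T(δx) = 1 − 1_{T<H(δx)} − 1_{T<H(wδx)}` (sequel W2-a (second half), the `tsum` regrouping). Quadratic
`E/F` with involution `c`, `c² = 1`; `G = U(J₃)`, `B = T·N` upper triangular. No measure theory. Companion
of ★ `UnitaryGroupSingularBorelClass` (singular class) and ★ `UnitaryGroupTruncatedKernelClassHyperbolic`
(«hyperbolic classes live in rational Borels»).

The hyperbolic torus point is the HYPOTHESIS `hg₀ : (g₀ : Matrix) = !![a, 0, 0; 0, b, 0; 0, 0, (c a)⁻¹]` and the
Weyl element the HYPOTHESIS `hw : (w : Matrix) = !![0, 0, 1; 0, 1, 0; 1, 0, 0]` (= `J₃`) on rational elements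
(existence: `exists_rational_eq_hyperbolicDiagonal`, `exists_rational_eq_weyl`) — no definition introduced.

* §1 (any field) `apply_eq_zero_of_mul_diagonal_eq_diagonal_mul`, **`offDiag_eq_zero_of_commute_diagonal`**
  (REGULAR RIGIDITY: the centraliser of a regular diagonal is diagonal), `apply_eq_zero_of_mul_diagonal_eq_revDiagonal_mul`.
* §2 **`exists_rational_eq_weyl`** (`w = J₃ ∈ U(J₃)(F)`), `weyl_mul_self`, `weyl_inv`, **`coe_weyl_conj_diagonal`**
  (`w d(τ₀,τ₁,τ₂) w⁻¹ = d(τ₂,τ₁,τ₀)`: the second torus point `γ₀^w`), `not_blockTriangular_weyl`,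
  `toAdelic_weyl_not_mem_borelAdelic` (`w ∉ B`).
* §3 **`diag_eq_or_of_blockTriangular_of_charpoly_eq_hyperbolic`** — a rational BOREL element of the class has
  diagonal `(a, b, (ca)⁻¹)` or `((ca)⁻¹, b, a)` («`𝔬 ∩ M = {γ₀, γ₀^w}`»).
* §4 the RATIONAL TWIST in two steps: `diag_relations_of_blockTriangular`, **`exists_unipotent_conj_eq_corner`**
  (`τ₀ ≠ τ₁`: remove the `x`-coordinate), **`exists_unipotent_conj_eq_diagonal_of_corner`** (`τ₀ ≠ τ₂`: remove the
  corner by a central `n(ζ)`) — so a Borel element with regular diagonal is `N(F)`-conjugate to its diagonal.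
* §5 `mem_borelOfForm_of_blockTriangular`, **`blockTriangular_of_commute_regular`** (`G_{γ₀}(F) = T(F) ≤ B(F)`),
  **`conj_mem_borel_iff_of_hyperbolic`**: `h γ₀ h⁻¹ ∈ B(F) ↔ h ∈ B(F) ∨ h w ∈ B(F)`.
* §6 (letters of `G(F) ≤ G(𝔸_F)`, `γ♯ = ι(γ₀)`, `w♯ = ι(w)`) **`conj_mem_arithmeticBorel_iff_of_hyperbolic`**,
  **`mem_arithmeticBorel_of_commute_hyperbolic`** (`δ γ♯ = γ♯ δ ⇒ δ ∈ B(F) ∧ w♯ δ w♯⁻¹ ∈ B(F)`: the weight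
  `u_T` is `G_γ(F)`-invariant), `mk_toAdelic_weyl_not_mem_arithmeticBorel`, `mk_toAdelic_weyl_mul_self`,
  **`out_conj_mem_arithmeticBorel_iff_of_hyperbolic`** — for `γ′ = δ₀⁻¹γ♯δ₀` and a right coset
  `q ∈ B(F)∖G(F)` with ★ `pseudoEisenstein`'s representative `q.out`: `q.out γ′ q.out⁻¹ ∈ B(F) ↔ q = B(F)δ₀ ∨
  q = B(F)w♯δ₀` — and **`mk_ne_mk_weyl_mul`** (the two cosets are distinct).
* §7 `exists_rational_eq_hyperbolicDiagonal`, `exists_unipotent_conj_eq_or_of_hyperbolic`,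
  **`exists_conj_eq_mk_toAdelic_of_hyperbolic`** — the class `((X − a)(X − b)(X − (ca)⁻¹)) ⊗ 𝔸_E` is ONE
  `G(F)`-conjugacy class, that of `γ♯` (so `K_𝔬(x,x) = Σ_{δ ∈ G_γ(F)∖G(F)} f(x⁻¹δ⁻¹γ♯δx)`).

What is NOT here (sequel files of the road): the `tsum`∕`finsum` regrouping of `k^T_𝔬` into the `j`-kernel
`Σ'_{δ ∈ T(F)∖G(F)} f(x⁻¹δ⁻¹γ♯δx)·u_T(δx)` minus the lattice-sum remainder (W2-a, second half), the
vanishing of the remainder's integral (W2-b), the unfolding over `T(F)∖G(𝔸_F)` (W2-c) and the rank-one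
interval `∫ u_T = 2 log T − log H(x) − log H(wx)` (W3) giving [Rogawski1990, (6.1.3)].

## References

* J. D. Rogawski, *Automorphic Representations of Unitary Groups in Three Variables*, Annals of
  Mathematics Studies 123 (1990), §1.10, §3.6 (p. 27), §6.1 (pp. 79–81), §7.2 (pp. 91–92, 97) [Rogawski1990].
* J. Arthur, *A trace formula for reductive groups I: terms associated to classes in `G(ℚ)`*, Duke
  Math. J. 45 (1978), §8 [Arthur1978TraceFormulaI].
-/

set_option autoImplicit false

noncomputable section

open NumberField IsDedekindDomain Matrix Polynomial
open scoped Classical MatrixGroups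

namespace Literature.NumberTheory.Automorphic

namespace UnitaryGroup

/-! ## §1 Regular rigidity: the centraliser of a regular diagonal matrix is diagonal (any field) -/

section Regular

variable {E : Type} [Field E]

/-- **Intertwiners of diagonal matrices vanish off the matching eigenvalues**: if
`h · diag(τ) = diag(τ′) · h` then `h i j = 0` whenever `τ′ i ≠ τ j` (entrywise
`(τ′ i − τ j) h i j = 0`) — the linear algebra behind «the centraliser of a regular element of `M` is `M`».
[cite: Rogawski1990, §3.6 (p. 27)] -/
theorem apply_eq_zero_of_mul_diagonal_eq_diagonal_mul {n : Type} [Fintype n] [DecidableEq n]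
    {τ τ' : n → E} {h : Matrix n n E} (heq : h * Matrix.diagonal τ = Matrix.diagonal τ' * h)
    {i j : n} (hij : τ' i ≠ τ j) : h i j = 0 := by
  have e := congrFun (congrFun heq i) j
  rw [Matrix.mul_diagonal, Matrix.diagonal_mul] at e
  have h0 : (τ' i - τ j) * h i j = 0 := by linear_combination e.symm
  exact (mul_eq_zero.1 h0).resolve_left (sub_ne_zero.2 hij)

/-- **REGULAR RIGIDITY**: a matrix commuting with a diagonal matrix with pairwise distinct entries
`(τ₀, τ₁, τ₂)` is diagonal (`h₀₁ = h₀₂ = h₁₀ = h₁₂ = h₂₀ = h₂₁ = 0`) — the centraliser of a regular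
element of the maximal torus `M` of `U(3)` is `M` [Rogawski1990, §3.6]. [cite: Rogawski1990, §3.6 (p. 27)] -/
theorem offDiag_eq_zero_of_commute_diagonal {τ₀ τ₁ τ₂ : E} (h01 : τ₀ ≠ τ₁) (h02 : τ₀ ≠ τ₂) (h12 : τ₁ ≠ τ₂)
    {h : Matrix (Fin 3) (Fin 3) E} (heq : h * !![τ₀, 0, 0; 0, τ₁, 0; 0, 0, τ₂] = !![τ₀, 0, 0; 0, τ₁, 0; 0, 0, τ₂] * h) :
    h 0 1 = 0 ∧ h 0 2 = 0 ∧ h 1 0 = 0 ∧ h 1 2 = 0 ∧ h 2 0 = 0 ∧ h 2 1 = 0 := by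
  have hd : (!![τ₀, 0, 0; 0, τ₁, 0; 0, 0, τ₂] : Matrix (Fin 3) (Fin 3) E) = Matrix.diagonal ![τ₀, τ₁, τ₂] := by
    ext i j; fin_cases i <;> fin_cases j <;> simp
  rw [hd] at heq
  refine ⟨?_, ?_, ?_, ?_, ?_, ?_⟩
  · exact apply_eq_zero_of_mul_diagonal_eq_diagonal_mul heq (by simpa using h01)
  · exact apply_eq_zero_of_mul_diagonal_eq_diagonal_mul heq (by simpa using h02)
  · exact apply_eq_zero_of_mul_diagonal_eq_diagonal_mul heq (by simpa using h01.symm)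
  · exact apply_eq_zero_of_mul_diagonal_eq_diagonal_mul heq (by simpa using h12)
  · exact apply_eq_zero_of_mul_diagonal_eq_diagonal_mul heq (by simpa using h02.symm)
  · exact apply_eq_zero_of_mul_diagonal_eq_diagonal_mul heq (by simpa using h12.symm)

/-- **The `w`-intertwiners**: a matrix `h` with `h · diag(τ₀,τ₁,τ₂) = diag(τ₂,τ₁,τ₀) · h` (pairwise distinct
`τ`) is supported on the anti-diagonal and the centre: `h₀₀ = h₀₁ = h₁₀ = h₁₂ = h₂₁ = h₂₂ = 0`. [cite: Rogawski1990, §3.6 (p. 27)] -/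
theorem apply_eq_zero_of_mul_diagonal_eq_revDiagonal_mul {τ₀ τ₁ τ₂ : E} (h01 : τ₀ ≠ τ₁) (h02 : τ₀ ≠ τ₂)
    (h12 : τ₁ ≠ τ₂) {h : Matrix (Fin 3) (Fin 3) E}
    (heq : h * !![τ₀, 0, 0; 0, τ₁, 0; 0, 0, τ₂] = !![τ₂, 0, 0; 0, τ₁, 0; 0, 0, τ₀] * h) :
    h 0 0 = 0 ∧ h 0 1 = 0 ∧ h 1 0 = 0 ∧ h 1 2 = 0 ∧ h 2 1 = 0 ∧ h 2 2 = 0 := by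
  have hd : (!![τ₀, 0, 0; 0, τ₁, 0; 0, 0, τ₂] : Matrix (Fin 3) (Fin 3) E) = Matrix.diagonal ![τ₀, τ₁, τ₂] := by
    ext i j; fin_cases i <;> fin_cases j <;> simp
  have hd' : (!![τ₂, 0, 0; 0, τ₁, 0; 0, 0, τ₀] : Matrix (Fin 3) (Fin 3) E) = Matrix.diagonal ![τ₂, τ₁, τ₀] := by
    ext i j; fin_cases i <;> fin_cases j <;> simp
  rw [hd, hd'] at heq
  refine ⟨?_, ?_, ?_, ?_, ?_, ?_⟩
  · exact apply_eq_zero_of_mul_diagonal_eq_diagonal_mul heq (by simpa using h02.symm)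
  · exact apply_eq_zero_of_mul_diagonal_eq_diagonal_mul heq (by simpa using h12.symm)
  · exact apply_eq_zero_of_mul_diagonal_eq_diagonal_mul heq (by simpa using h01.symm)
  · exact apply_eq_zero_of_mul_diagonal_eq_diagonal_mul heq (by simpa using h12)
  · exact apply_eq_zero_of_mul_diagonal_eq_diagonal_mul heq (by simpa using h01)
  · exact apply_eq_zero_of_mul_diagonal_eq_diagonal_mul heq (by simpa using h02)

end Regular

/-! ## §2 The Weyl element `w = J₃` of `U(J₃)(F)` -/

section Weyl

variable {F E : Type} [Field F] [NumberField F] [Field E] [NumberField E] [Algebra F E]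
  {c : E ≃ₐ[F] E}

/-- `rev 1 = 1` in `Fin 3`. [folklore] -/
private theorem rev1' : Fin.rev (1 : Fin 3) = 1 := rfl

/-- `rev 2 = 0` in `Fin 3`. [folklore] -/
private theorem rev2' : Fin.rev (2 : Fin 3) = 0 := rfl

omit [NumberField E] in
/-- `det J₃ = -1 ≠ 0`. [folklore] -/
private theorem det_weyl_ne_zero : (!![(0 : E), 0, 1; 0, 1, 0; 1, 0, 0] : Matrix (Fin 3) (Fin 3) E).det ≠ 0 := by
  rw [Matrix.det_fin_three]; simp

/-- **The Weyl element `w = J₃ = antidiag(1,1,1)` lies in `U(J₃)(F)`** (`ᵗ(cJ) J J = J³ = J`): the non-trivial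
element of the Weyl group `Ω(M)` of the maximal torus, `w d(α,β,γ) w⁻¹ = d(γ,β,α)` [Rogawski1990, §6.1 p. 80:
«`w` … a representative for the unique non-trivial element in `Ω(M)`»]. [cite: Rogawski1990, §6.1 (p. 80)] -/
theorem exists_rational_eq_weyl :
    ∃ w : (quasiSplit F E c 3).Rational, ((w.1 : GL (Fin 3) E) : Matrix (Fin 3) (Fin 3) E) = !![(0 : E), 0, 1; 0, 1, 0; 1, 0, 0] := by
  refine ⟨⟨Matrix.GeneralLinearGroup.mkOfDetNeZero _ det_weyl_ne_zero, ?_⟩,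
    Matrix.GeneralLinearGroup.val_mkOfDetNeZero _ _⟩
  change Matrix.GeneralLinearGroup.mkOfDetNeZero _ det_weyl_ne_zero ∈
    unitaryGroupOfForm (c : E →+* E) ((StdForm.antidiagonal 3).over E)
  rw [mem_unitaryGroupOfForm_antidiagonal_iff_sum']
  intro i j
  fin_cases i <;> fin_cases j <;>
    simp [Fin.sum_univ_three, rev1', rev2', Matrix.GeneralLinearGroup.val_mkOfDetNeZero]

/-- `w² = 1`. [cite: Rogawski1990, §6.1 (p. 80)] -/
theorem weyl_mul_self {w : (quasiSplit F E c 3).Rational}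
    (hw : ((w.1 : GL (Fin 3) E) : Matrix (Fin 3) (Fin 3) E) = !![(0 : E), 0, 1; 0, 1, 0; 1, 0, 0]) : w * w = 1 := by
  apply Subtype.ext
  apply Matrix.GeneralLinearGroup.ext
  intro i j
  change (((w.1 : GL (Fin 3) E) * (w.1 : GL (Fin 3) E) : GL (Fin 3) E) : Matrix (Fin 3) (Fin 3) E) i j =
    ((1 : GL (Fin 3) E) : Matrix (Fin 3) (Fin 3) E) i j
  rw [Units.val_mul, hw, Units.val_one]
  fin_cases i <;> fin_cases j <;> simp [Matrix.mul_apply, Fin.sum_univ_three]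

/-- `w⁻¹ = w`. [cite: Rogawski1990, §6.1 (p. 80)] -/
theorem weyl_inv {w : (quasiSplit F E c 3).Rational}
    (hw : ((w.1 : GL (Fin 3) E) : Matrix (Fin 3) (Fin 3) E) = !![(0 : E), 0, 1; 0, 1, 0; 1, 0, 0]) : w⁻¹ = w :=
  inv_eq_of_mul_eq_one_right (weyl_mul_self hw)

/-- **`w` reverses the diagonal**: `w · !![τ₀,0,0;0,τ₁,0;0,0,τ₂] · w⁻¹ = !![τ₂,0,0;0,τ₁,0;0,0,τ₀]` — for
`γ₀ = d(a, b, (ca)⁻¹)` this is the second torus point `γ₀^w = d((ca)⁻¹, b, a)` of its class.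
[cite: Rogawski1990, §6.1 (p. 80)] -/
theorem coe_weyl_conj_diagonal {w g : (quasiSplit F E c 3).Rational}
    (hw : ((w.1 : GL (Fin 3) E) : Matrix (Fin 3) (Fin 3) E) = !![(0 : E), 0, 1; 0, 1, 0; 1, 0, 0]) {τ₀ τ₁ τ₂ : E}
    (hg : ((g.1 : GL (Fin 3) E) : Matrix (Fin 3) (Fin 3) E) = !![τ₀, 0, 0; 0, τ₁, 0; 0, 0, τ₂]) :
    (((w * g * w⁻¹).1 : GL (Fin 3) E) : Matrix (Fin 3) (Fin 3) E) = !![τ₂, 0, 0; 0, τ₁, 0; 0, 0, τ₀] := by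
  rw [weyl_inv hw]
  change (((w.1 : GL (Fin 3) E) * (g.1 : GL (Fin 3) E) * (w.1 : GL (Fin 3) E) : GL (Fin 3) E) :
      Matrix (Fin 3) (Fin 3) E) = _
  rw [Units.val_mul, Units.val_mul, hw, hg]
  ext i j
  fin_cases i <;> fin_cases j <;> simp [Matrix.mul_apply, Fin.sum_univ_three]

/-- **`w ∉ B(F)`**: `w` is not upper triangular. [cite: Rogawski1990, §6.1 (p. 80)] -/
theorem not_blockTriangular_weyl {w : (quasiSplit F E c 3).Rational}
    (hw : ((w.1 : GL (Fin 3) E) : Matrix (Fin 3) (Fin 3) E) = !![(0 : E), 0, 1; 0, 1, 0; 1, 0, 0]) :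
    ¬ (((w.1 : GL (Fin 3) E) : Matrix (Fin 3) (Fin 3) E)).BlockTriangular id := by
  intro h
  have h20 : ((w.1 : GL (Fin 3) E) : Matrix (Fin 3) (Fin 3) E) 2 0 = 0 := h (show ((0 : Fin 3) : Fin 3) < 2 by decide)
  rw [hw] at h20
  simp at h20

/-- `ι(w) ∉ B(𝔸_F)`, so its image in `G(F)` is not in `B(F)`. [cite: Rogawski1990, §6.1 (p. 80)] -/
theorem toAdelic_weyl_not_mem_borelAdelic {w : (quasiSplit F E c 3).Rational}
    (hw : ((w.1 : GL (Fin 3) E) : Matrix (Fin 3) (Fin 3) E) = !![(0 : E), 0, 1; 0, 1, 0; 1, 0, 0]) :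
    (quasiSplit F E c 3).toAdelic w ∉ borelAdelic F E c 3 := fun h =>
  not_blockTriangular_weyl hw ((toAdelic_mem_borelAdelic_iff w).1 h)

end Weyl

/-! ## §3 The diagonal of a Borel element of the regular hyperbolic class -/

section Diagonal

variable {F E : Type} [Field F] [NumberField F] [Field E] [NumberField E] [Algebra F E]
  {c : E ≃ₐ[F] E}

omit [NumberField F] [NumberField E] in
/-- `c (c x) = x` for an involution `c`. [folklore] -/
private theorem conj_conj'' (hc : c * c = 1) (x : E) : c (c x) = x := by
  rw [← AlgEquiv.mul_apply, hc, AlgEquiv.one_apply]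

omit [NumberField E] in
/-- A root of `(X − a)(X − b)(X − d)` is `a`, `b` or `d`. [folklore] -/
private theorem eq_or_eq_or_eq_of_eval_eq_zero {a b d x : E} (h : ((X - C a) * (X - C b) * (X - C d)).eval x = 0) :
    x = a ∨ x = b ∨ x = d := by
  simp only [eval_mul, eval_sub, eval_X, eval_C, mul_eq_zero, sub_eq_zero, or_assoc] at h
  exact h

/-- **The diagonal of a rational Borel element of the regular hyperbolic class is `(a, b, (ca)⁻¹)` or
`((ca)⁻¹, b, a)`**: for `β ∈ U(J₃)(F)` upper triangular with characteristic polynomial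
`(X − a)(X − b)(X − (ca)⁻¹)`, `c a · a ≠ 1`, `b ∈ E¹` — the two elements `γ₀ = d(a,b,ā⁻¹)`, `γ₀^w` of
`𝔬 ∩ M` [Rogawski1990, §6.1: «the integral depends only on the orbit of `γ` under `Ω(M)`»].
[cite: Rogawski1990, §6.1 (pp. 79–80)] -/
theorem diag_eq_or_of_blockTriangular_of_charpoly_eq_hyperbolic (hc : c * c = 1) {a b : Eˣ}
    (ha : c (a : E) * (a : E) ≠ 1) (hb : c (b : E) * (b : E) = 1) {β : (quasiSplit F E c 3).Rational}
    (hB : (((β.1 : GL (Fin 3) E) : Matrix (Fin 3) (Fin 3) E)).BlockTriangular id)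
    (hp : (((β.1 : GL (Fin 3) E) : Matrix (Fin 3) (Fin 3) E)).charpoly =
      (X - C (a : E)) * (X - C (b : E)) * (X - C (c (a : E))⁻¹)) :
    (((β.1 : GL (Fin 3) E) : Matrix (Fin 3) (Fin 3) E) 0 0 = a ∧
      ((β.1 : GL (Fin 3) E) : Matrix (Fin 3) (Fin 3) E) 1 1 = b ∧
      ((β.1 : GL (Fin 3) E) : Matrix (Fin 3) (Fin 3) E) 2 2 = (c (a : E))⁻¹) ∨
    (((β.1 : GL (Fin 3) E) : Matrix (Fin 3) (Fin 3) E) 0 0 = (c (a : E))⁻¹ ∧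
      ((β.1 : GL (Fin 3) E) : Matrix (Fin 3) (Fin 3) E) 1 1 = b ∧
      ((β.1 : GL (Fin 3) E) : Matrix (Fin 3) (Fin 3) E) 2 2 = a) := by
  obtain ⟨hab, haa', hba'⟩ := hyperbolic_roots_pairwise_ne (F := F) hc ha hb
  have ha0 : c (a : E) ≠ 0 := by rw [map_ne_zero_iff _ c.injective]; exact a.ne_zero
  obtain ⟨u, -, d, hdT, hd, -⟩ :=
    exists_unipotent_mul_torus_of_mem_borelOfForm (σ := (c : E →+* E)) (N := 3) (b := (β.1 : GL (Fin 3) E)) ⟨β.2, hB⟩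
  have hrel : ∀ i, c (d (Fin.rev i) : E) * (d i : E) = 1 := by
    have h := (glDiagonal_mem_unitaryGroupOfForm_antidiagonal_iff (c : E →+* E) 3 d).1
      (torusOfForm_le_borelOfForm hdT).1
    intro i
    have hi := h i
    rwa [RingHom.coe_coe] at hi
  have hchar : (X - C (d 0 : E)) * (X - C (d 1 : E)) * (X - C (d 2 : E)) =
      (X - C (a : E)) * (X - C (b : E)) * (X - C (c (a : E))⁻¹) := by
    rw [← hp, Matrix.charpoly_of_upperTriangular _ hB, Fin.prod_univ_three, ← hd 0, ← hd 1, ← hd 2]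
  have heval : ∀ x : E, ((X - C (d 0 : E)) * (X - C (d 1 : E)) * (X - C (d 2 : E))).eval x =
      ((X - C (a : E)) * (X - C (b : E)) * (X - C (c (a : E))⁻¹)).eval x := fun x => by rw [hchar]
  have root : ∀ i : Fin 3, (d i : E) = a ∨ (d i : E) = b ∨ (d i : E) = (c (a : E))⁻¹ := by
    intro i
    apply eq_or_eq_or_eq_of_eval_eq_zero
    rw [← heval]
    fin_cases i <;> simp
  -- `d₁ ∈ E¹`, hence `d₁ = b`
  have h11 : c (d 1 : E) * (d 1 : E) = 1 := hrel 1
  have hd1 : (d 1 : E) = b := by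
    rcases root 1 with h | h | h
    · exact absurd (h ▸ h11) ha
    · exact h
    · exfalso
      rw [h, map_inv₀, conj_conj'' hc] at h11
      apply ha
      have h2 : (c (a : E) * (a : E))⁻¹ = 1 := by rw [_root_.mul_inv_rev]; exact h11
      exact inv_eq_one.1 h2
  -- `c(d₂) d₀ = 1`
  have h20 : c (d 2 : E) * (d 0 : E) = 1 := hrel 0
  -- `d₀ ≠ b`
  have hd0 : (d 0 : E) = a ∨ (d 0 : E) = (c (a : E))⁻¹ := by
    rcases root 0 with h | h | h
    · exact Or.inl h
    · exfalso
      -- then `d₂ = b` too and `a` would be a root of `(X − b)³`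
      have hd2 : (d 2 : E) = b := by
        have hx : c (d 2 : E) * (b : E) = 1 := by rw [← h]; exact h20
        have hcb : c (d 2 : E) = c (b : E) := by
          rw [eq_inv_of_mul_eq_one_left hx, eq_inv_of_mul_eq_one_left hb]
        exact c.injective hcb
      have ha' := heval (a : E)
      simp only [eval_mul, eval_sub, eval_X, eval_C, sub_self, zero_mul, h, hd1, hd2] at ha'
      rcases mul_eq_zero.1 ha' with h1 | h1
      · rcases mul_eq_zero.1 h1 with h2 | h2 <;> exact hab (sub_eq_zero.1 h2)
      · exact hab (sub_eq_zero.1 h1)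
    · exact Or.inr h
  rcases hd0 with h0 | h0
  · -- `d₀ = a` ⇒ `d₂ = (ca)⁻¹`
    refine Or.inl ⟨(hd 0).symm.trans h0, (hd 1).symm.trans hd1, (hd 2).symm.trans ?_⟩
    rw [h0] at h20
    have h2 : c (d 2 : E) = (a : E)⁻¹ := eq_inv_of_mul_eq_one_left h20
    have h3 : (d 2 : E) = c ((a : E)⁻¹) := by rw [← h2, conj_conj'' hc]
    rw [h3, map_inv₀]
  · -- `d₀ = (ca)⁻¹` ⇒ `d₂ = a`
    refine Or.inr ⟨(hd 0).symm.trans h0, (hd 1).symm.trans hd1, (hd 2).symm.trans ?_⟩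
    rw [h0] at h20
    have h2 : c (d 2 : E) = c (a : E) := by
      have := eq_inv_of_mul_eq_one_left h20
      rwa [inv_inv] at this
    exact c.injective h2

end Diagonal

/-! ## §4 `N(F)`-conjugation of a Borel element with regular diagonal onto its diagonal (the rational twist) -/

section Twist

variable {F E : Type} [Field F] [NumberField F] [Field E] [NumberField E] [Algebra F E]
  {c : E ≃ₐ[F] E}

/-- The three unitarity relations of the diagonal of an upper triangular `β ∈ U(J₃)(F)`:
`c(β₂₂) β₀₀ = 1`, `c(β₁₁) β₁₁ = 1`, `c(β₀₀) β₂₂ = 1` (its Levi part lies in `T(F)`). [cite: Rogawski1990, §1.10] -/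
theorem diag_relations_of_blockTriangular {β : (quasiSplit F E c 3).Rational}
    (hB : (((β.1 : GL (Fin 3) E) : Matrix (Fin 3) (Fin 3) E)).BlockTriangular id) :
    c (((β.1 : GL (Fin 3) E) : Matrix (Fin 3) (Fin 3) E) 2 2) * ((β.1 : GL (Fin 3) E) : Matrix (Fin 3) (Fin 3) E) 0 0 = 1 ∧
    c (((β.1 : GL (Fin 3) E) : Matrix (Fin 3) (Fin 3) E) 1 1) * ((β.1 : GL (Fin 3) E) : Matrix (Fin 3) (Fin 3) E) 1 1 = 1 ∧
    c (((β.1 : GL (Fin 3) E) : Matrix (Fin 3) (Fin 3) E) 0 0) * ((β.1 : GL (Fin 3) E) : Matrix (Fin 3) (Fin 3) E) 2 2 = 1 := by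
  obtain ⟨u, -, d, hdT, hd, -⟩ :=
    exists_unipotent_mul_torus_of_mem_borelOfForm (σ := (c : E →+* E)) (N := 3) (b := (β.1 : GL (Fin 3) E)) ⟨β.2, hB⟩
  have hrel : ∀ i, c (d (Fin.rev i) : E) * (d i : E) = 1 := by
    have h := (glDiagonal_mem_unitaryGroupOfForm_antidiagonal_iff (c : E →+* E) 3 d).1
      (torusOfForm_le_borelOfForm hdT).1
    intro i
    have hi := h i
    rwa [RingHom.coe_coe] at hi
  refine ⟨?_, ?_, ?_⟩
  · rw [← hd 0, ← hd 2]; exact hrel 0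
  · rw [← hd 1]; exact hrel 1
  · rw [← hd 0, ← hd 2]; exact hrel 2

/-- **STEP 1 — removing the `x`-coordinate** (`α₁ = τ₀/τ₁ ≠ 1`): an upper triangular `β ∈ U(J₃)(F)` with
`β₀₀ ≠ β₁₁` is conjugate by an element of `N(F)` to `!![τ₀, 0, z₁; 0, τ₁, 0; 0, 0, τ₂]` (same diagonal; the
`(1,2)` entry then vanishes by unitarity). [cite: Rogawski1990, §7.2 (pp. 91–92, 97)] -/
theorem exists_unipotent_conj_eq_corner (hc : c * c = 1) {β : (quasiSplit F E c 3).Rational} {τ₀ τ₁ τ₂ x y z : E}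
    (hβ : ((β.1 : GL (Fin 3) E) : Matrix (Fin 3) (Fin 3) E) = !![τ₀, x, z; 0, τ₁, y; 0, 0, τ₂]) (h01 : τ₀ ≠ τ₁) :
    ∃ u : (quasiSplit F E c 3).Rational, (u.1 : GL (Fin 3) E) ∈ unipotentOfForm (c : E →+* E) 3 ∧
      ∃ z₁ : E, (((u * β * u⁻¹).1 : GL (Fin 3) E) : Matrix (Fin 3) (Fin 3) E) = !![τ₀, 0, z₁; 0, τ₁, 0; 0, 0, τ₂] := by
  have hB : (((β.1 : GL (Fin 3) E) : Matrix (Fin 3) (Fin 3) E)).BlockTriangular id := by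
    rw [hβ]; intro i j hij; fin_cases i <;> fin_cases j <;> simp_all
  obtain ⟨hrel0, hrel1, hrel2⟩ := diag_relations_of_blockTriangular hB
  rw [hβ] at hrel0 hrel1 hrel2
  simp at hrel0 hrel1 hrel2
  -- the `(1,2)` unitarity relation `c(x) τ₂ + c(τ₁) y = 0`
  have hU := (mem_unitaryGroupOfForm_antidiagonal_iff_sum' (c : E →+* E) 3 (β.1 : GL (Fin 3) E)).1 β.2
  have hy := hU 1 2
  rw [hβ] at hy
  simp [Fin.sum_univ_three, rev1', rev2'] at hy
  have hyval : y = -(c x * τ₂ * τ₁) := by linear_combination τ₁ * hy - y * hrel1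
  -- parameters
  have h01' : τ₀ - τ₁ ≠ 0 := sub_ne_zero.2 h01
  obtain ⟨s, hs⟩ : ∃ s : E, s * (τ₀ - τ₁) = x := ⟨x / (τ₀ - τ₁), div_mul_cancel₀ x h01'⟩
  have hcs : c s * (c τ₀ - c τ₁) = c x := by rw [← map_sub, ← map_mul, hs]
  obtain ⟨t, hct, ht⟩ : ∃ t : E, c t = t ∧ 2 * t = -(s * c s) := by
    refine ⟨-(s * c s) / 2, ?_, ?_⟩
    · rw [map_div₀, map_neg, map_mul, conj_conj'' hc, map_ofNat, mul_comm (c s) s]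
    · field_simp
  have hUdet : (!![(1 : E), s, t; 0, 1, -c s; 0, 0, 1] : Matrix (Fin 3) (Fin 3) E).det ≠ 0 := by
    rw [Matrix.det_fin_three]; simp
  have hUunit : Matrix.GeneralLinearGroup.mkOfDetNeZero _ hUdet ∈
      unitaryGroupOfForm (c : E →+* E) ((StdForm.antidiagonal 3).over E) := by
    rw [mem_unitaryGroupOfForm_antidiagonal_iff_sum']
    have hccs : c (c s) = s := conj_conj'' hc s
    intro i j
    fin_cases i <;> fin_cases j <;>
      simp [Fin.sum_univ_three, rev1', rev2', Matrix.GeneralLinearGroup.val_mkOfDetNeZero, map_neg, hccs, hct]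
    · linear_combination ht
  refine ⟨⟨Matrix.GeneralLinearGroup.mkOfDetNeZero _ hUdet, hUunit⟩,
    mem_unipotentOfForm_iff.2 ⟨hUunit, (mem_upperUnitriangular_iff _).2 ⟨?_, ?_⟩⟩, z + s * y + t * (τ₂ - τ₀), ?_⟩
  · rw [Matrix.GeneralLinearGroup.val_mkOfDetNeZero]
    intro i j hij
    fin_cases i <;> fin_cases j <;> simp_all
  · rw [Matrix.GeneralLinearGroup.val_mkOfDetNeZero]
    intro i
    fin_cases i <;> simp
  · have key : !![(1 : E), s, t; 0, 1, -c s; 0, 0, 1] * !![τ₀, x, z; 0, τ₁, y; 0, 0, τ₂] =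
        !![τ₀, 0, z + s * y + t * (τ₂ - τ₀); 0, τ₁, 0; 0, 0, τ₂] * !![(1 : E), s, t; 0, 1, -c s; 0, 0, 1] := by
      ext i j
      fin_cases i <;> fin_cases j <;> simp [Matrix.mul_apply, Fin.sum_univ_three]
      · linear_combination -hs
      · ring
      · linear_combination hyval + (τ₁ * τ₂) * hcs + (c s * τ₂) * hrel1 - (c s * τ₁) * hrel2
    have hinv : !![(1 : E), s, t; 0, 1, -c s; 0, 0, 1] * (!![(1 : E), s, t; 0, 1, -c s; 0, 0, 1])⁻¹ = 1 :=
      Matrix.mul_nonsing_inv _ (Ne.isUnit hUdet)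
    change (((Matrix.GeneralLinearGroup.mkOfDetNeZero _ hUdet * (β.1 : GL (Fin 3) E) *
        (Matrix.GeneralLinearGroup.mkOfDetNeZero _ hUdet)⁻¹ : GL (Fin 3) E)) : Matrix (Fin 3) (Fin 3) E) = _
    rw [Units.val_mul, Units.val_mul, Matrix.coe_units_inv, Matrix.GeneralLinearGroup.val_mkOfDetNeZero, hβ, key,
      Matrix.mul_assoc, hinv, Matrix.mul_one]

/-- **STEP 2 — removing the corner** (`τ₀ ≠ τ₂`, the split root): `!![τ₀, 0, z₁; 0, τ₁, 0; 0, 0, τ₂] ∈ U(J₃)(F)`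
with `τ₀ ≠ τ₂` is conjugate by a CENTRAL element `n(ζ)` of `N(F)` to the diagonal `d(τ₀, τ₁, τ₂)`.
[cite: Rogawski1990, §7.2 (pp. 91–92, 97)] -/
theorem exists_unipotent_conj_eq_diagonal_of_corner {β : (quasiSplit F E c 3).Rational}
    {τ₀ τ₁ τ₂ z₁ : E}
    (hβ : ((β.1 : GL (Fin 3) E) : Matrix (Fin 3) (Fin 3) E) = !![τ₀, 0, z₁; 0, τ₁, 0; 0, 0, τ₂]) (h02 : τ₀ ≠ τ₂) :
    ∃ u : (quasiSplit F E c 3).Rational, (u.1 : GL (Fin 3) E) ∈ unipotentOfForm (c : E →+* E) 3 ∧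
      (((u * β * u⁻¹).1 : GL (Fin 3) E) : Matrix (Fin 3) (Fin 3) E) = !![τ₀, 0, 0; 0, τ₁, 0; 0, 0, τ₂] := by
  have hB : (((β.1 : GL (Fin 3) E) : Matrix (Fin 3) (Fin 3) E)).BlockTriangular id := by
    rw [hβ]; intro i j hij; fin_cases i <;> fin_cases j <;> simp_all
  obtain ⟨hrel0, hrel1, hrel2⟩ := diag_relations_of_blockTriangular hB
  rw [hβ] at hrel0 hrel1 hrel2
  simp at hrel0 hrel1 hrel2
  -- the `(2,2)` unitarity relation `c(z₁) τ₂ + c(τ₂) z₁ = 0`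
  have hU := (mem_unitaryGroupOfForm_antidiagonal_iff_sum' (c : E →+* E) 3 (β.1 : GL (Fin 3) E)).1 β.2
  have hz := hU 2 2
  rw [hβ] at hz
  simp [Fin.sum_univ_three, rev1', rev2'] at hz
  have h02' : τ₀ - τ₂ ≠ 0 := sub_ne_zero.2 h02
  have hτ₀ : τ₀ ≠ 0 := fun h0 => by rw [h0, mul_zero] at hrel0; exact zero_ne_one hrel0
  have hτ₂ : τ₂ ≠ 0 := fun h0 => by rw [h0, mul_zero] at hrel2; exact zero_ne_one hrel2
  obtain ⟨ζ, hζ⟩ : ∃ ζ : E, ζ * (τ₀ - τ₂) = z₁ := ⟨z₁ / (τ₀ - τ₂), div_mul_cancel₀ z₁ h02'⟩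
  have hcζ' : c ζ * (c τ₀ - c τ₂) = c z₁ := by rw [← map_sub, ← map_mul, hζ]
  have hcζ : c ζ = -ζ := by
    have h3 : (c ζ + ζ) * (τ₀ - τ₂) = 0 := by
      linear_combination (τ₀ * τ₂) * hcζ' + τ₀ * hz + hζ - (c ζ * τ₀) * hrel2 + (c ζ * τ₂) * hrel0 - z₁ * hrel0
    linear_combination (mul_eq_zero.1 h3).resolve_right h02'
  have hUdet : (!![(1 : E), 0, ζ; 0, 1, 0; 0, 0, 1] : Matrix (Fin 3) (Fin 3) E).det ≠ 0 := by
    rw [Matrix.det_fin_three]; simp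
  have hUunit : Matrix.GeneralLinearGroup.mkOfDetNeZero _ hUdet ∈
      unitaryGroupOfForm (c : E →+* E) ((StdForm.antidiagonal 3).over E) := by
    rw [mem_unitaryGroupOfForm_antidiagonal_iff_sum']
    intro i j
    fin_cases i <;> fin_cases j <;>
      simp [Fin.sum_univ_three, rev1', rev2', Matrix.GeneralLinearGroup.val_mkOfDetNeZero, hcζ]
  refine ⟨⟨Matrix.GeneralLinearGroup.mkOfDetNeZero _ hUdet, hUunit⟩,
    mem_unipotentOfForm_iff.2 ⟨hUunit, (mem_upperUnitriangular_iff _).2 ⟨?_, ?_⟩⟩, ?_⟩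
  · rw [Matrix.GeneralLinearGroup.val_mkOfDetNeZero]
    intro i j hij
    fin_cases i <;> fin_cases j <;> simp_all
  · rw [Matrix.GeneralLinearGroup.val_mkOfDetNeZero]
    intro i
    fin_cases i <;> simp
  · have key : !![(1 : E), 0, ζ; 0, 1, 0; 0, 0, 1] * !![τ₀, 0, z₁; 0, τ₁, 0; 0, 0, τ₂] =
        !![τ₀, 0, 0; 0, τ₁, 0; 0, 0, τ₂] * !![(1 : E), 0, ζ; 0, 1, 0; 0, 0, 1] := by
      ext i j
      fin_cases i <;> fin_cases j <;> simp [Matrix.mul_apply, Fin.sum_univ_three]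
      · linear_combination -hζ
    have hinv : !![(1 : E), 0, ζ; 0, 1, 0; 0, 0, 1] * (!![(1 : E), 0, ζ; 0, 1, 0; 0, 0, 1])⁻¹ = 1 :=
      Matrix.mul_nonsing_inv _ (Ne.isUnit hUdet)
    change (((Matrix.GeneralLinearGroup.mkOfDetNeZero _ hUdet * (β.1 : GL (Fin 3) E) *
        (Matrix.GeneralLinearGroup.mkOfDetNeZero _ hUdet)⁻¹ : GL (Fin 3) E)) : Matrix (Fin 3) (Fin 3) E) = _
    rw [Units.val_mul, Units.val_mul, Matrix.coe_units_inv, Matrix.GeneralLinearGroup.val_mkOfDetNeZero, hβ, key,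
      Matrix.mul_assoc, hinv, Matrix.mul_one]

end Twist

/-! ## §5 The two rational Borels through `γ₀`: `{h ∈ G(F) ∣ h γ₀ h⁻¹ ∈ B(F)} = B(F) ⊔ B(F)·w` -/

section TwoBorels

variable {F E : Type} [Field F] [NumberField F] [Field E] [NumberField E] [Algebra F E]
  {c : E ≃ₐ[F] E}

/-- A rational element whose matrix is upper triangular lies in the Borel subgroup `borelOfForm`. [cite: Rogawski1990, §1.10] -/
theorem mem_borelOfForm_of_blockTriangular {h : (quasiSplit F E c 3).Rational}
    (hB : (((h.1 : GL (Fin 3) E) : Matrix (Fin 3) (Fin 3) E)).BlockTriangular id) :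
    (h.1 : GL (Fin 3) E) ∈ borelOfForm (c : E →+* E) 3 := ⟨h.2, hB⟩

/-- **An element of `U(J₃)(F)` commuting with a regular diagonal `γ₀ = d(τ₀, τ₁, τ₂)` is diagonal**, in
particular upper triangular: the centraliser `G_{γ₀}(F) = T(F) ≤ B(F)`. [cite: Rogawski1990, §3.6 (p. 27)] -/
theorem blockTriangular_of_commute_regular {g₀ h : (quasiSplit F E c 3).Rational} {τ₀ τ₁ τ₂ : E}
    (hg₀ : ((g₀.1 : GL (Fin 3) E) : Matrix (Fin 3) (Fin 3) E) = !![τ₀, 0, 0; 0, τ₁, 0; 0, 0, τ₂])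
    (h01 : τ₀ ≠ τ₁) (h02 : τ₀ ≠ τ₂) (h12 : τ₁ ≠ τ₂) (hcomm : h * g₀ = g₀ * h) :
    (((h.1 : GL (Fin 3) E) : Matrix (Fin 3) (Fin 3) E)).BlockTriangular id ∧
      ((h.1 : GL (Fin 3) E) : Matrix (Fin 3) (Fin 3) E) 0 1 = 0 ∧
      ((h.1 : GL (Fin 3) E) : Matrix (Fin 3) (Fin 3) E) 0 2 = 0 ∧
      ((h.1 : GL (Fin 3) E) : Matrix (Fin 3) (Fin 3) E) 1 2 = 0 := by
  have heq : ((h.1 : GL (Fin 3) E) : Matrix (Fin 3) (Fin 3) E) * !![τ₀, 0, 0; 0, τ₁, 0; 0, 0, τ₂] =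
      !![τ₀, 0, 0; 0, τ₁, 0; 0, 0, τ₂] * ((h.1 : GL (Fin 3) E) : Matrix (Fin 3) (Fin 3) E) := by
    rw [← hg₀, ← Units.val_mul, ← Units.val_mul]
    exact congrArg (fun x : (quasiSplit F E c 3).Rational => ((x.1 : GL (Fin 3) E) : Matrix (Fin 3) (Fin 3) E)) hcomm
  obtain ⟨h01', h02', h10, h12', h20, h21⟩ := offDiag_eq_zero_of_commute_diagonal h01 h02 h12 heq
  refine ⟨?_, h01', h02', h12'⟩
  intro i j hij
  fin_cases i <;> fin_cases j <;> simp_all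

/-- **THE TWO RATIONAL BORELS THROUGH A REGULAR HYPERBOLIC ELEMENT.** For `γ₀ = d(a, b, (ca)⁻¹) ∈ T(F)`
regular hyperbolic (`c a · a ≠ 1`, `b ∈ E¹`), `w` the Weyl element and `h ∈ U(J₃)(F)`:
`h γ₀ h⁻¹ ∈ B(F) ↔ h ∈ B(F) ∨ h·w ∈ B(F)` — `γ₀^h` lies in exactly the two Borel subgroups `B^{h}`-related to
`B ⊃ T` and `B^w ⊃ T`, the input of the weighted-orbital-integral regrouping of `k^T_𝔬`
[Rogawski1990, §6.1 (6.1.1)–(6.1.3): `W(g) = 2T − H(g) − H(wg)`; Arthur 1978 §8]. Proof: `⇐` by the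
diagonal form of `w γ₀ w⁻¹`; `⇒` by §3–§4 (`N(F)`-conjugation of `h γ₀ h⁻¹ ∈ B(F)` to `γ₀` or `γ₀^w`) and the
regular rigidity of §1. [cite: Rogawski1990, §6.1 (pp. 79–81)] [cite: Arthur1978TraceFormulaI, §8] -/
theorem conj_mem_borel_iff_of_hyperbolic (hc : c * c = 1) {a b : Eˣ} (ha : c (a : E) * (a : E) ≠ 1)
    (hb : c (b : E) * (b : E) = 1) {g₀ w h : (quasiSplit F E c 3).Rational}
    (hg₀ : ((g₀.1 : GL (Fin 3) E) : Matrix (Fin 3) (Fin 3) E) = !![(a : E), 0, 0; 0, b, 0; 0, 0, (c (a : E))⁻¹])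
    (hw : ((w.1 : GL (Fin 3) E) : Matrix (Fin 3) (Fin 3) E) = !![(0 : E), 0, 1; 0, 1, 0; 1, 0, 0]) :
    ((((h * g₀ * h⁻¹).1 : GL (Fin 3) E) : Matrix (Fin 3) (Fin 3) E)).BlockTriangular id ↔
      (((h.1 : GL (Fin 3) E) : Matrix (Fin 3) (Fin 3) E)).BlockTriangular id ∨
      ((((h * w).1 : GL (Fin 3) E) : Matrix (Fin 3) (Fin 3) E)).BlockTriangular id := by
  obtain ⟨hab, haa', hba'⟩ := hyperbolic_roots_pairwise_ne (F := F) hc ha hb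
  have hg₀B : (g₀.1 : GL (Fin 3) E) ∈ borelOfForm (c : E →+* E) 3 :=
    mem_borelOfForm_of_blockTriangular (by rw [hg₀]; intro i j hij; fin_cases i <;> fin_cases j <;> simp_all)
  -- `w γ₀ w⁻¹ = d((ca)⁻¹, b, a)` is diagonal, hence in `B(F)`
  have hwg := coe_weyl_conj_diagonal hw hg₀
  have hwg₀B : ((w * g₀ * w⁻¹).1 : GL (Fin 3) E) ∈ borelOfForm (c : E →+* E) 3 :=
    mem_borelOfForm_of_blockTriangular (by rw [hwg]; intro i j hij; fin_cases i <;> fin_cases j <;> simp_all)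
  constructor
  · intro hβB
    -- the characteristic polynomial of the conjugate
    have hp : ((((h * g₀ * h⁻¹).1 : GL (Fin 3) E) : Matrix (Fin 3) (Fin 3) E)).charpoly =
        (X - C (a : E)) * (X - C (b : E)) * (X - C (c (a : E))⁻¹) := by
      change ((((h.1 : GL (Fin 3) E) * (g₀.1 : GL (Fin 3) E) * (h.1 : GL (Fin 3) E)⁻¹ : GL (Fin 3) E)) :
        Matrix (Fin 3) (Fin 3) E).charpoly = _
      rw [Units.val_mul, Units.val_mul, Matrix.coe_units_inv, Matrix.charpoly_units_conj, hg₀,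
        Matrix.charpoly_of_upperTriangular _ (by intro i j hij; fin_cases i <;> fin_cases j <;> simp_all),
        Fin.prod_univ_three]
      simp
    rcases diag_eq_or_of_blockTriangular_of_charpoly_eq_hyperbolic hc ha hb hβB hp with ⟨h00, h11, h22⟩ | ⟨h00, h11, h22⟩
    · -- diagonal `(a, b, (ca)⁻¹)`: conjugate into `γ₀` itself
      left
      set β := h * g₀ * h⁻¹ with hβdef
      have hβmat : ((β.1 : GL (Fin 3) E) : Matrix (Fin 3) (Fin 3) E) =
          !![(a : E), ((β.1 : GL (Fin 3) E) : Matrix (Fin 3) (Fin 3) E) 0 1, ((β.1 : GL (Fin 3) E) : Matrix (Fin 3) (Fin 3) E) 0 2;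
            0, b, ((β.1 : GL (Fin 3) E) : Matrix (Fin 3) (Fin 3) E) 1 2; 0, 0, (c (a : E))⁻¹] := by
        have h10 : ((β.1 : GL (Fin 3) E) : Matrix (Fin 3) (Fin 3) E) 1 0 = 0 := hβB (show ((0 : Fin 3) : Fin 3) < 1 by decide)
        have h20 : ((β.1 : GL (Fin 3) E) : Matrix (Fin 3) (Fin 3) E) 2 0 = 0 := hβB (show ((0 : Fin 3) : Fin 3) < 2 by decide)
        have h21 : ((β.1 : GL (Fin 3) E) : Matrix (Fin 3) (Fin 3) E) 2 1 = 0 := hβB (show ((1 : Fin 3) : Fin 3) < 2 by decide)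
        ext i j; fin_cases i <;> fin_cases j <;> simp [h00, h11, h22, h10, h20, h21]
      obtain ⟨u₁, hu₁, z₁, hu₁β⟩ := exists_unipotent_conj_eq_corner hc hβmat hab
      obtain ⟨u₂, hu₂, hu₂β⟩ := exists_unipotent_conj_eq_diagonal_of_corner hu₁β haa'
      -- `η := u₂ u₁` conjugates `β` to `γ₀`, so `η h` commutes with `γ₀`
      have hηβ : u₂ * u₁ * β * (u₂ * u₁)⁻¹ = g₀ := by
        apply Subtype.ext
        apply Units.ext
        rw [← hg₀] at hu₂β
        have : u₂ * u₁ * β * (u₂ * u₁)⁻¹ = u₂ * (u₁ * β * u₁⁻¹) * u₂⁻¹ := by group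
        rw [this]
        exact hu₂β
      have hcomm : (u₂ * u₁ * h) * g₀ = g₀ * (u₂ * u₁ * h) := by
        have : u₂ * u₁ * h * g₀ = (u₂ * u₁ * β * (u₂ * u₁)⁻¹) * (u₂ * u₁ * h) := by rw [hβdef]; group
        rw [this, hηβ]
      have hηhB := (blockTriangular_of_commute_regular hg₀ hab haa' hba' hcomm).1
      -- `h = (u₂ u₁)⁻¹ · (u₂ u₁ h)` with both factors in `B(F)`
      have hmem : (h.1 : GL (Fin 3) E) ∈ borelOfForm (c : E →+* E) 3 := by
        have : h = (u₂ * u₁)⁻¹ * (u₂ * u₁ * h) := by group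
        rw [this]
        exact Subgroup.mul_mem _ (Subgroup.inv_mem _ (Subgroup.mul_mem _ (unipotentOfForm_le_borelOfForm hu₂)
          (unipotentOfForm_le_borelOfForm hu₁))) (mem_borelOfForm_of_blockTriangular hηhB)
      exact hmem.2
    · -- diagonal `((ca)⁻¹, b, a)`: conjugate into `w γ₀ w⁻¹`
      right
      set β := h * g₀ * h⁻¹ with hβdef
      have hβmat : ((β.1 : GL (Fin 3) E) : Matrix (Fin 3) (Fin 3) E) =
          !![(c (a : E))⁻¹, ((β.1 : GL (Fin 3) E) : Matrix (Fin 3) (Fin 3) E) 0 1, ((β.1 : GL (Fin 3) E) : Matrix (Fin 3) (Fin 3) E) 0 2;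
            0, b, ((β.1 : GL (Fin 3) E) : Matrix (Fin 3) (Fin 3) E) 1 2; 0, 0, (a : E)] := by
        have h10 : ((β.1 : GL (Fin 3) E) : Matrix (Fin 3) (Fin 3) E) 1 0 = 0 := hβB (show ((0 : Fin 3) : Fin 3) < 1 by decide)
        have h20 : ((β.1 : GL (Fin 3) E) : Matrix (Fin 3) (Fin 3) E) 2 0 = 0 := hβB (show ((0 : Fin 3) : Fin 3) < 2 by decide)
        have h21 : ((β.1 : GL (Fin 3) E) : Matrix (Fin 3) (Fin 3) E) 2 1 = 0 := hβB (show ((1 : Fin 3) : Fin 3) < 2 by decide)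
        ext i j; fin_cases i <;> fin_cases j <;> simp [h00, h11, h22, h10, h20, h21]
      obtain ⟨u₁, hu₁, z₁, hu₁β⟩ := exists_unipotent_conj_eq_corner hc hβmat hba'.symm
      obtain ⟨u₂, hu₂, hu₂β⟩ := exists_unipotent_conj_eq_diagonal_of_corner hu₁β haa'.symm
      have hηβ : u₂ * u₁ * β * (u₂ * u₁)⁻¹ = w * g₀ * w⁻¹ := by
        apply Subtype.ext
        apply Units.ext
        rw [← hwg] at hu₂β
        have : u₂ * u₁ * β * (u₂ * u₁)⁻¹ = u₂ * (u₁ * β * u₁⁻¹) * u₂⁻¹ := by group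
        rw [this]
        exact hu₂β
      -- `d := w⁻¹ (u₂ u₁) h` commutes with `γ₀`
      have hcomm : (w⁻¹ * (u₂ * u₁) * h) * g₀ = g₀ * (w⁻¹ * (u₂ * u₁) * h) := by
        have : w⁻¹ * (u₂ * u₁) * h * g₀ = w⁻¹ * (u₂ * u₁ * β * (u₂ * u₁)⁻¹) * w * (w⁻¹ * (u₂ * u₁) * h) := by
          rw [hβdef]; group
        rw [this, hηβ]
        group
      have hd := blockTriangular_of_commute_regular hg₀ hab haa' hba' hcomm
      -- the diagonal matrix of `d`
      set d := w⁻¹ * (u₂ * u₁) * h with hddef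
      have hdmat : ((d.1 : GL (Fin 3) E) : Matrix (Fin 3) (Fin 3) E) =
          !![((d.1 : GL (Fin 3) E) : Matrix (Fin 3) (Fin 3) E) 0 0, 0, 0; 0, ((d.1 : GL (Fin 3) E) : Matrix (Fin 3) (Fin 3) E) 1 1, 0;
            0, 0, ((d.1 : GL (Fin 3) E) : Matrix (Fin 3) (Fin 3) E) 2 2] := by
        obtain ⟨hdB, hd01, hd02, hd12⟩ := hd
        have hd10 : ((d.1 : GL (Fin 3) E) : Matrix (Fin 3) (Fin 3) E) 1 0 = 0 := hdB (show ((0 : Fin 3) : Fin 3) < 1 by decide)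
        have hd20 : ((d.1 : GL (Fin 3) E) : Matrix (Fin 3) (Fin 3) E) 2 0 = 0 := hdB (show ((0 : Fin 3) : Fin 3) < 2 by decide)
        have hd21 : ((d.1 : GL (Fin 3) E) : Matrix (Fin 3) (Fin 3) E) 2 1 = 0 := hdB (show ((1 : Fin 3) : Fin 3) < 2 by decide)
        ext i j; fin_cases i <;> fin_cases j <;> simp [hd01, hd02, hd12, hd10, hd20, hd21]
      -- `h w = (u₂ u₁)⁻¹ · (w d w⁻¹)` with both factors in `B(F)`
      have hwdw := coe_weyl_conj_diagonal hw hdmat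
      have hmem : ((h * w).1 : GL (Fin 3) E) ∈ borelOfForm (c : E →+* E) 3 := by
        have e1 : h * w = (u₂ * u₁)⁻¹ * (w * d * w⁻¹) := by
          rw [hddef]
          have e : (u₂ * u₁)⁻¹ * (w * (w⁻¹ * (u₂ * u₁) * h) * w⁻¹) = h * w⁻¹ := by group
          rw [e, weyl_inv hw]
        rw [e1]
        exact Subgroup.mul_mem _ (Subgroup.inv_mem _ (Subgroup.mul_mem _ (unipotentOfForm_le_borelOfForm hu₂)
          (unipotentOfForm_le_borelOfForm hu₁)))
          (mem_borelOfForm_of_blockTriangular (by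
            rw [hwdw]; intro i j hij
            fin_cases i <;> fin_cases j <;> first | exact absurd hij (by decide) | simp))
      exact hmem.2
  · rintro (hhB | hhwB)
    · have hmem : ((h * g₀ * h⁻¹).1 : GL (Fin 3) E) ∈ borelOfForm (c : E →+* E) 3 :=
        Subgroup.mul_mem _ (Subgroup.mul_mem _ (mem_borelOfForm_of_blockTriangular hhB) hg₀B)
          (Subgroup.inv_mem _ (mem_borelOfForm_of_blockTriangular hhB))
      exact hmem.2
    · have heq : h * g₀ * h⁻¹ = (h * w) * (w * g₀ * w⁻¹) * (h * w)⁻¹ := by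
        have e : (h * w) * (w * g₀ * w⁻¹) * (h * w)⁻¹ = h * (w * w) * g₀ * (w * w)⁻¹ * h⁻¹ := by group
        rw [e, weyl_mul_self hw, inv_one, mul_one, mul_one]
      rw [heq]
      have hmem : (((h * w) * (w * g₀ * w⁻¹) * (h * w)⁻¹).1 : GL (Fin 3) E) ∈ borelOfForm (c : E →+* E) 3 :=
        Subgroup.mul_mem _ (Subgroup.mul_mem _ (mem_borelOfForm_of_blockTriangular hhwB) hwg₀B)
          (Subgroup.inv_mem _ (mem_borelOfForm_of_blockTriangular hhwB))
      exact hmem.2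

end TwoBorels

/-! ## §6 In the letters of `G(F) ≤ G(𝔸_F)`: the two cosets of `B(F)∖G(F)` carrying a hyperbolic element -/

section Arithmetic

variable {F E : Type} [Field F] [NumberField F] [Field E] [NumberField E] [Algebra F E]
  {c : E ≃ₐ[F] E}

/-- The diagonal embedding `U(J₃)(F) → U(J₃)(𝔸_F)` is injective (`E → 𝔸_E` is). [folklore] -/
private theorem toAdelic_injective₃ : Function.Injective ((quasiSplit F E c 3).toAdelic) := by
  intro γ γ' h
  apply Subtype.ext
  apply Matrix.GeneralLinearGroup.ext
  intro i j
  have hij := congrArg (fun g : (quasiSplit F E c 3).Adelic =>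
    ((adelicVal F E c 3 _ g : GL (Fin 3) (AdeleRing (𝓞 E) E)) : Matrix (Fin 3) (Fin 3) (AdeleRing (𝓞 E) E)) i j) h
  exact AdeleRing.algebraMap_injective (𝓞 E) E hij

/-- The image in `G(F)` of a rational element. [folklore] -/
private theorem coe_mk_toAdelic (g : (quasiSplit F E c 3).Rational) :
    ((⟨(quasiSplit F E c 3).toAdelic g, g, rfl⟩ : (quasiSplit F E c 3).arithmeticSubgroup) : (quasiSplit F E c 3).Adelic) =
      (quasiSplit F E c 3).toAdelic g := rfl

/-- **THE TWO RATIONAL BORELS, in `G(F)`**: for `γ♯ = ι(γ₀)`, `γ₀ = d(a,b,(ca)⁻¹)` regular hyperbolic, `w♯ = ι(w)`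
and `δ ∈ G(F)`: `δ γ♯ δ⁻¹ ∈ B(F) ↔ δ ∈ B(F) ∨ δ w♯ ∈ B(F)`. [cite: Rogawski1990, §6.1 (pp. 79–81)]
[cite: Arthur1978TraceFormulaI, §8] -/
theorem conj_mem_arithmeticBorel_iff_of_hyperbolic (hc : c * c = 1) {a b : Eˣ} (ha : c (a : E) * (a : E) ≠ 1)
    (hb : c (b : E) * (b : E) = 1) {g₀ w : (quasiSplit F E c 3).Rational}
    (hg₀ : ((g₀.1 : GL (Fin 3) E) : Matrix (Fin 3) (Fin 3) E) = !![(a : E), 0, 0; 0, b, 0; 0, 0, (c (a : E))⁻¹])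
    (hw : ((w.1 : GL (Fin 3) E) : Matrix (Fin 3) (Fin 3) E) = !![(0 : E), 0, 1; 0, 1, 0; 1, 0, 0])
    (δ : (quasiSplit F E c 3).arithmeticSubgroup) :
    δ * ⟨(quasiSplit F E c 3).toAdelic g₀, g₀, rfl⟩ * δ⁻¹ ∈ arithmeticBorel F E c 3 ↔
      δ ∈ arithmeticBorel F E c 3 ∨ δ * ⟨(quasiSplit F E c 3).toAdelic w, w, rfl⟩ ∈ arithmeticBorel F E c 3 := by
  obtain ⟨h, hh⟩ := δ.2
  have e1 : ((δ * ⟨(quasiSplit F E c 3).toAdelic g₀, g₀, rfl⟩ * δ⁻¹ : (quasiSplit F E c 3).arithmeticSubgroup) :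
      (quasiSplit F E c 3).Adelic) = (quasiSplit F E c 3).toAdelic (h * g₀ * h⁻¹) := by
    rw [map_mul, map_mul, map_inv, hh]; rfl
  have e2 : ((δ : (quasiSplit F E c 3).arithmeticSubgroup) : (quasiSplit F E c 3).Adelic) = (quasiSplit F E c 3).toAdelic h :=
    hh.symm
  have e3 : ((δ * ⟨(quasiSplit F E c 3).toAdelic w, w, rfl⟩ : (quasiSplit F E c 3).arithmeticSubgroup) :
      (quasiSplit F E c 3).Adelic) = (quasiSplit F E c 3).toAdelic (h * w) := by
    rw [map_mul, hh]; rfl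
  rw [mem_arithmeticBorel_iff, mem_arithmeticBorel_iff, mem_arithmeticBorel_iff, e1, e2, e3,
    toAdelic_mem_borelAdelic_iff, toAdelic_mem_borelAdelic_iff, toAdelic_mem_borelAdelic_iff]
  exact conj_mem_borel_iff_of_hyperbolic hc ha hb hg₀ hw

/-- **The centraliser of `γ♯` in `G(F)` lies in `B(F)` and is normalised by `w♯` into `B(F)`**: if
`δ γ♯ = γ♯ δ` then `δ ∈ B(F)` and `w♯ δ w♯⁻¹ ∈ B(F)` (both are diagonal) — so the heights `H(δ y) = H(y)` and
`H(w♯ δ y) = H(w♯ y)` are `G_{γ}(F)`-invariant (★ `borelHeight_rational_borel_mul`), as the weight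
`2T − H(x) − H(wx)` of [Rogawski1990, §6.1] must be. [cite: Rogawski1990, §3.6 (p. 27); §6.1 (p. 80)] -/
theorem mem_arithmeticBorel_of_commute_hyperbolic (hc : c * c = 1) {a b : Eˣ} (ha : c (a : E) * (a : E) ≠ 1)
    (hb : c (b : E) * (b : E) = 1) {g₀ w : (quasiSplit F E c 3).Rational}
    (hg₀ : ((g₀.1 : GL (Fin 3) E) : Matrix (Fin 3) (Fin 3) E) = !![(a : E), 0, 0; 0, b, 0; 0, 0, (c (a : E))⁻¹])
    (hw : ((w.1 : GL (Fin 3) E) : Matrix (Fin 3) (Fin 3) E) = !![(0 : E), 0, 1; 0, 1, 0; 1, 0, 0])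
    {δ : (quasiSplit F E c 3).arithmeticSubgroup}
    (hδ : δ * ⟨(quasiSplit F E c 3).toAdelic g₀, g₀, rfl⟩ = ⟨(quasiSplit F E c 3).toAdelic g₀, g₀, rfl⟩ * δ) :
    δ ∈ arithmeticBorel F E c 3 ∧
      ⟨(quasiSplit F E c 3).toAdelic w, w, rfl⟩ * δ * (⟨(quasiSplit F E c 3).toAdelic w, w, rfl⟩)⁻¹ ∈ arithmeticBorel F E c 3 := by
  obtain ⟨hab, haa', hba'⟩ := hyperbolic_roots_pairwise_ne (F := F) hc ha hb
  obtain ⟨h, hh⟩ := δ.2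
  have hcomm : h * g₀ = g₀ * h := by
    apply toAdelic_injective₃
    rw [map_mul, map_mul, hh]
    exact congrArg (fun x : (quasiSplit F E c 3).arithmeticSubgroup => (x : (quasiSplit F E c 3).Adelic)) hδ
  obtain ⟨hB, h01, h02, h12⟩ := blockTriangular_of_commute_regular hg₀ hab haa' hba' hcomm
  have hdmat : ((h.1 : GL (Fin 3) E) : Matrix (Fin 3) (Fin 3) E) =
      !![((h.1 : GL (Fin 3) E) : Matrix (Fin 3) (Fin 3) E) 0 0, 0, 0; 0, ((h.1 : GL (Fin 3) E) : Matrix (Fin 3) (Fin 3) E) 1 1, 0;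
        0, 0, ((h.1 : GL (Fin 3) E) : Matrix (Fin 3) (Fin 3) E) 2 2] := by
    have h10 : ((h.1 : GL (Fin 3) E) : Matrix (Fin 3) (Fin 3) E) 1 0 = 0 := hB (show ((0 : Fin 3) : Fin 3) < 1 by decide)
    have h20 : ((h.1 : GL (Fin 3) E) : Matrix (Fin 3) (Fin 3) E) 2 0 = 0 := hB (show ((0 : Fin 3) : Fin 3) < 2 by decide)
    have h21 : ((h.1 : GL (Fin 3) E) : Matrix (Fin 3) (Fin 3) E) 2 1 = 0 := hB (show ((1 : Fin 3) : Fin 3) < 2 by decide)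
    ext i j; fin_cases i <;> fin_cases j <;> simp [h01, h02, h12, h10, h20, h21]
  have hwdw := coe_weyl_conj_diagonal hw hdmat
  have e2 : ((δ : (quasiSplit F E c 3).arithmeticSubgroup) : (quasiSplit F E c 3).Adelic) = (quasiSplit F E c 3).toAdelic h :=
    hh.symm
  have e3 : ((⟨(quasiSplit F E c 3).toAdelic w, w, rfl⟩ * δ * (⟨(quasiSplit F E c 3).toAdelic w, w, rfl⟩)⁻¹ :
      (quasiSplit F E c 3).arithmeticSubgroup) : (quasiSplit F E c 3).Adelic) = (quasiSplit F E c 3).toAdelic (w * h * w⁻¹) := by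
    rw [map_mul, map_mul, map_inv, hh]; rfl
  refine ⟨?_, ?_⟩
  · rw [mem_arithmeticBorel_iff, e2, toAdelic_mem_borelAdelic_iff]; exact hB
  · rw [mem_arithmeticBorel_iff, e3, toAdelic_mem_borelAdelic_iff, hwdw]
    intro i j hij
    fin_cases i <;> fin_cases j <;> first | exact absurd hij (by decide) | simp

/-- `w♯ ∉ B(F)` in `G(F)`. [cite: Rogawski1990, §6.1 (p. 80)] -/
theorem mk_toAdelic_weyl_not_mem_arithmeticBorel {w : (quasiSplit F E c 3).Rational}
    (hw : ((w.1 : GL (Fin 3) E) : Matrix (Fin 3) (Fin 3) E) = !![(0 : E), 0, 1; 0, 1, 0; 1, 0, 0]) :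
    (⟨(quasiSplit F E c 3).toAdelic w, w, rfl⟩ : (quasiSplit F E c 3).arithmeticSubgroup) ∉ arithmeticBorel F E c 3 := by
  rw [mem_arithmeticBorel_iff]
  exact toAdelic_weyl_not_mem_borelAdelic hw

/-- `w♯ · w♯ = 1` in `G(F)`. [cite: Rogawski1990, §6.1 (p. 80)] -/
theorem mk_toAdelic_weyl_mul_self {w : (quasiSplit F E c 3).Rational}
    (hw : ((w.1 : GL (Fin 3) E) : Matrix (Fin 3) (Fin 3) E) = !![(0 : E), 0, 1; 0, 1, 0; 1, 0, 0]) :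
    (⟨(quasiSplit F E c 3).toAdelic w, w, rfl⟩ : (quasiSplit F E c 3).arithmeticSubgroup) *
      ⟨(quasiSplit F E c 3).toAdelic w, w, rfl⟩ = 1 := by
  apply Subtype.ext
  change (quasiSplit F E c 3).toAdelic w * (quasiSplit F E c 3).toAdelic w = 1
  rw [← map_mul, weyl_mul_self hw, map_one]

/-- **EXACTLY TWO COSETS OF `B(F)∖G(F)` CARRY A GIVEN HYPERBOLIC ELEMENT**: for `γ′ = δ₀⁻¹ γ♯ δ₀` and a right
coset `q ∈ B(F)∖G(F)` (with the representative `q.out` of ★ `pseudoEisenstein`), `q.out γ′ q.out⁻¹ ∈ B(F)`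
iff `q = B(F)δ₀` or `q = B(F) w♯ δ₀` — the index set of the terms of `K_{B,𝔬}(δx, δx)`, `δ ∈ B(F)∖G(F)`,
containing `γ′`, whose cut-offs `1_{T<H(δ₀x)}`, `1_{T<H(w δ₀ x)}` assemble Arthur's weight
`1 − τ̂(H(x) − T) − τ̂(H(wx) − T)` [Rogawski1990, (6.1.1)–(6.1.3)]. [cite: Rogawski1990, §6.1 (pp. 79–81)]
[cite: Arthur1978TraceFormulaI, §8] -/
theorem out_conj_mem_arithmeticBorel_iff_of_hyperbolic (hc : c * c = 1) {a b : Eˣ} (ha : c (a : E) * (a : E) ≠ 1)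
    (hb : c (b : E) * (b : E) = 1) {g₀ w : (quasiSplit F E c 3).Rational}
    (hg₀ : ((g₀.1 : GL (Fin 3) E) : Matrix (Fin 3) (Fin 3) E) = !![(a : E), 0, 0; 0, b, 0; 0, 0, (c (a : E))⁻¹])
    (hw : ((w.1 : GL (Fin 3) E) : Matrix (Fin 3) (Fin 3) E) = !![(0 : E), 0, 1; 0, 1, 0; 1, 0, 0])
    (δ₀ : (quasiSplit F E c 3).arithmeticSubgroup) (q : Quotient (QuotientGroup.rightRel (arithmeticBorel F E c 3))) :
    q.out * (δ₀⁻¹ * ⟨(quasiSplit F E c 3).toAdelic g₀, g₀, rfl⟩ * δ₀) * q.out⁻¹ ∈ arithmeticBorel F E c 3 ↔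
      q = Quotient.mk (QuotientGroup.rightRel (arithmeticBorel F E c 3)) δ₀ ∨
      q = Quotient.mk (QuotientGroup.rightRel (arithmeticBorel F E c 3)) (⟨(quasiSplit F E c 3).toAdelic w, w, rfl⟩ * δ₀) := by
  set γ := (⟨(quasiSplit F E c 3).toAdelic g₀, g₀, rfl⟩ : (quasiSplit F E c 3).arithmeticSubgroup) with hγ
  set ws := (⟨(quasiSplit F E c 3).toAdelic w, w, rfl⟩ : (quasiSplit F E c 3).arithmeticSubgroup) with hws
  have hrw : q.out * (δ₀⁻¹ * γ * δ₀) * q.out⁻¹ = (q.out * δ₀⁻¹) * γ * (q.out * δ₀⁻¹)⁻¹ := by group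
  rw [hrw, conj_mem_arithmeticBorel_iff_of_hyperbolic hc ha hb hg₀ hw (q.out * δ₀⁻¹)]
  have hws2 : ws * ws = 1 := mk_toAdelic_weyl_mul_self hw
  have hwsinv : ws⁻¹ = ws := inv_eq_of_mul_eq_one_right hws2
  -- `q = B δ ↔ δ q.out⁻¹ ∈ B`
  have key : ∀ δ : (quasiSplit F E c 3).arithmeticSubgroup,
      q = Quotient.mk (QuotientGroup.rightRel (arithmeticBorel F E c 3)) δ ↔ q.out * δ⁻¹ ∈ arithmeticBorel F E c 3 := by
    intro δ
    conv_lhs => rw [← Quotient.out_eq q]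
    rw [Quotient.eq, QuotientGroup.rightRel_apply]
    constructor
    · intro h; have h' := Subgroup.inv_mem _ h; rwa [_root_.mul_inv_rev, inv_inv] at h'
    · intro h; have h' := Subgroup.inv_mem _ h; rwa [_root_.mul_inv_rev, inv_inv] at h'
  rw [key δ₀, key (ws * δ₀), _root_.mul_inv_rev, hwsinv, ← mul_assoc]

/-- The two cosets are DISTINCT (`w♯ ∉ B(F)`). [cite: Rogawski1990, §6.1 (p. 80)] -/
theorem mk_ne_mk_weyl_mul {w : (quasiSplit F E c 3).Rational}
    (hw : ((w.1 : GL (Fin 3) E) : Matrix (Fin 3) (Fin 3) E) = !![(0 : E), 0, 1; 0, 1, 0; 1, 0, 0])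
    (δ₀ : (quasiSplit F E c 3).arithmeticSubgroup) :
    Quotient.mk (QuotientGroup.rightRel (arithmeticBorel F E c 3)) δ₀ ≠
      Quotient.mk (QuotientGroup.rightRel (arithmeticBorel F E c 3)) (⟨(quasiSplit F E c 3).toAdelic w, w, rfl⟩ * δ₀) := by
  intro h
  rw [Quotient.eq, QuotientGroup.rightRel_apply, mul_inv_cancel_right] at h
  exact mk_toAdelic_weyl_not_mem_arithmeticBorel hw h

end Arithmetic

/-! ## §7 The regular hyperbolic class is ONE `G(F)`-conjugacy class -/

section OneClass

variable {F E : Type} [Field F] [NumberField F] [Field E] [NumberField E] [Algebra F E]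
  {c : E ≃ₐ[F] E}

/-- **`γ₀ = d(a, b, (ca)⁻¹) ∈ U(J₃)(F)`** for `b ∈ E¹` (★ `glDiagonal_mem_rational_of_diag`). [cite: Rogawski1990, §1.10; §6.1 (p. 79)] -/
theorem exists_rational_eq_hyperbolicDiagonal (hc : c * c = 1) (a b : Eˣ) (hb : c (b : E) * (b : E) = 1) :
    ∃ g₀ : (quasiSplit F E c 3).Rational,
      ((g₀.1 : GL (Fin 3) E) : Matrix (Fin 3) (Fin 3) E) = !![(a : E), 0, 0; 0, b, 0; 0, 0, (c (a : E))⁻¹] := by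
  have ha0 : c (a : E) ≠ 0 := by rw [map_ne_zero_iff _ c.injective]; exact a.ne_zero
  set a' : Eˣ := Units.mk0 (c (a : E))⁻¹ (inv_ne_zero ha0) with ha'
  set d : Fin 3 → Eˣ := ![a, b, a'] with hdd
  have hd : ∀ i, c (d (Fin.rev i) : E) * (d i : E) = 1 := by
    intro i
    fin_cases i
    · change c (a' : E) * (a : E) = 1
      rw [ha', Units.val_mk0, map_inv₀, conj_conj'' hc, inv_mul_cancel₀ a.ne_zero]
    · exact hb
    · change c (a : E) * (a' : E) = 1
      rw [ha', Units.val_mk0, mul_inv_cancel₀ ha0]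
  refine ⟨⟨glDiagonal 3 E d, glDiagonal_mem_rational_of_diag (F := F) d hd⟩, ?_⟩
  change ((glDiagonal 3 E d : GL (Fin 3) E) : Matrix (Fin 3) (Fin 3) E) = _
  rw [coe_glDiagonal]
  ext i j; fin_cases i <;> fin_cases j <;> simp [hdd, ha']

/-- **Every rational Borel element of the class is `B(F)∪B(F)w`… precisely: `N(F)`-conjugate to `γ₀` or to
`γ₀^w = w γ₀ w⁻¹`** (§3 + §4). [cite: Rogawski1990, §6.1 (pp. 79–80)] -/
theorem exists_unipotent_conj_eq_or_of_hyperbolic (hc : c * c = 1) {a b : Eˣ} (ha : c (a : E) * (a : E) ≠ 1)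
    (hb : c (b : E) * (b : E) = 1) {β : (quasiSplit F E c 3).Rational}
    (hB : (((β.1 : GL (Fin 3) E) : Matrix (Fin 3) (Fin 3) E)).BlockTriangular id)
    (hp : (((β.1 : GL (Fin 3) E) : Matrix (Fin 3) (Fin 3) E)).charpoly =
      (X - C (a : E)) * (X - C (b : E)) * (X - C (c (a : E))⁻¹)) :
    ∃ u : (quasiSplit F E c 3).Rational, (u.1 : GL (Fin 3) E) ∈ borelOfForm (c : E →+* E) 3 ∧
      ((((u * β * u⁻¹).1 : GL (Fin 3) E) : Matrix (Fin 3) (Fin 3) E) = !![(a : E), 0, 0; 0, b, 0; 0, 0, (c (a : E))⁻¹] ∨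
       (((u * β * u⁻¹).1 : GL (Fin 3) E) : Matrix (Fin 3) (Fin 3) E) = !![(c (a : E))⁻¹, 0, 0; 0, b, 0; 0, 0, (a : E)]) := by
  obtain ⟨hab, haa', hba'⟩ := hyperbolic_roots_pairwise_ne (F := F) hc ha hb
  have h10 : ((β.1 : GL (Fin 3) E) : Matrix (Fin 3) (Fin 3) E) 1 0 = 0 := hB (show ((0 : Fin 3) : Fin 3) < 1 by decide)
  have h20 : ((β.1 : GL (Fin 3) E) : Matrix (Fin 3) (Fin 3) E) 2 0 = 0 := hB (show ((0 : Fin 3) : Fin 3) < 2 by decide)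
  have h21 : ((β.1 : GL (Fin 3) E) : Matrix (Fin 3) (Fin 3) E) 2 1 = 0 := hB (show ((1 : Fin 3) : Fin 3) < 2 by decide)
  rcases diag_eq_or_of_blockTriangular_of_charpoly_eq_hyperbolic hc ha hb hB hp with ⟨h00, h11, h22⟩ | ⟨h00, h11, h22⟩
  · have hβmat : ((β.1 : GL (Fin 3) E) : Matrix (Fin 3) (Fin 3) E) =
        !![(a : E), ((β.1 : GL (Fin 3) E) : Matrix (Fin 3) (Fin 3) E) 0 1, ((β.1 : GL (Fin 3) E) : Matrix (Fin 3) (Fin 3) E) 0 2;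
          0, b, ((β.1 : GL (Fin 3) E) : Matrix (Fin 3) (Fin 3) E) 1 2; 0, 0, (c (a : E))⁻¹] := by
      ext i j; fin_cases i <;> fin_cases j <;> simp [h00, h11, h22, h10, h20, h21]
    obtain ⟨u₁, hu₁, z₁, hu₁β⟩ := exists_unipotent_conj_eq_corner hc hβmat hab
    obtain ⟨u₂, hu₂, hu₂β⟩ := exists_unipotent_conj_eq_diagonal_of_corner hu₁β haa'
    refine ⟨u₂ * u₁, Subgroup.mul_mem _ (unipotentOfForm_le_borelOfForm hu₂) (unipotentOfForm_le_borelOfForm hu₁), Or.inl ?_⟩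
    have : u₂ * u₁ * β * (u₂ * u₁)⁻¹ = u₂ * (u₁ * β * u₁⁻¹) * u₂⁻¹ := by group
    rw [this]; exact hu₂β
  · have hβmat : ((β.1 : GL (Fin 3) E) : Matrix (Fin 3) (Fin 3) E) =
        !![(c (a : E))⁻¹, ((β.1 : GL (Fin 3) E) : Matrix (Fin 3) (Fin 3) E) 0 1, ((β.1 : GL (Fin 3) E) : Matrix (Fin 3) (Fin 3) E) 0 2;
          0, b, ((β.1 : GL (Fin 3) E) : Matrix (Fin 3) (Fin 3) E) 1 2; 0, 0, (a : E)] := by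
      ext i j; fin_cases i <;> fin_cases j <;> simp [h00, h11, h22, h10, h20, h21]
    obtain ⟨u₁, hu₁, z₁, hu₁β⟩ := exists_unipotent_conj_eq_corner hc hβmat hba'.symm
    obtain ⟨u₂, hu₂, hu₂β⟩ := exists_unipotent_conj_eq_diagonal_of_corner hu₁β haa'.symm
    refine ⟨u₂ * u₁, Subgroup.mul_mem _ (unipotentOfForm_le_borelOfForm hu₂) (unipotentOfForm_le_borelOfForm hu₁), Or.inr ?_⟩
    have : u₂ * u₁ * β * (u₂ * u₁)⁻¹ = u₂ * (u₁ * β * u₁⁻¹) * u₂⁻¹ := by group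
    rw [this]; exact hu₂β

/-- **THE REGULAR HYPERBOLIC CLASS IS A SINGLE `G(F)`-CONJUGACY CLASS**: every `γ′ ∈ G(F)` with
characteristic-polynomial class `((X − a)(X − b)(X − (ca)⁻¹)) ⊗ 𝔸_E` (`c a · a ≠ 1`, `b ∈ E¹`) is
`G(F)`-conjugate to `γ♯ = ι(d(a, b, (ca)⁻¹))` — ★ `forall_exists_conj_mem_arithmeticBorel_of_hyperbolic`
(into `B(F)`), then §4 (to `γ₀` or `γ₀^w`), then `w`. So `K_𝔬(x,x) = Σ_{δ ∈ G_γ(F)∖G(F)} f(x⁻¹ δ⁻¹ γ♯ δ x)` for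
this class [Rogawski1990, §6.1 (6.1.1)]. [cite: Rogawski1990, §6.1 (pp. 79–81)] [cite: Arthur1978TraceFormulaI, §8] -/
theorem exists_conj_eq_mk_toAdelic_of_hyperbolic (hc : c * c = 1) {a b : Eˣ} (ha : c (a : E) * (a : E) ≠ 1)
    (hb : c (b : E) * (b : E) = 1) {g₀ w : (quasiSplit F E c 3).Rational}
    (hg₀ : ((g₀.1 : GL (Fin 3) E) : Matrix (Fin 3) (Fin 3) E) = !![(a : E), 0, 0; 0, b, 0; 0, 0, (c (a : E))⁻¹])
    (hw : ((w.1 : GL (Fin 3) E) : Matrix (Fin 3) (Fin 3) E) = !![(0 : E), 0, 1; 0, 1, 0; 1, 0, 0])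
    {γ : (quasiSplit F E c 3).arithmeticSubgroup}
    (hγ : ((adelicVal F E c 3 _ (γ : (quasiSplit F E c 3).Adelic) : GL (Fin 3) (AdeleRing (𝓞 E) E)) :
        Matrix (Fin 3) (Fin 3) (AdeleRing (𝓞 E) E)).charpoly =
      ((X - C (a : E)) * (X - C (b : E)) * (X - C (c (a : E))⁻¹)).map (algebraMap E (AdeleRing (𝓞 E) E))) :
    ∃ δ : (quasiSplit F E c 3).arithmeticSubgroup, δ * γ * δ⁻¹ = ⟨(quasiSplit F E c 3).toAdelic g₀, g₀, rfl⟩ := by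
  obtain ⟨δ, hδB⟩ := forall_exists_conj_mem_arithmeticBorel_of_hyperbolic (F := F) hc b ha γ hγ
  obtain ⟨β₀, hβ₀⟩ := (δ * γ * δ⁻¹).2
  have hB : (((β₀.1 : GL (Fin 3) E) : Matrix (Fin 3) (Fin 3) E)).BlockTriangular id := by
    refine (toAdelic_mem_borelAdelic_iff β₀).1 ?_
    rw [hβ₀]
    exact (mem_arithmeticBorel_iff _).1 hδB
  have hp : (((β₀.1 : GL (Fin 3) E) : Matrix (Fin 3) (Fin 3) E)).charpoly =
      (X - C (a : E)) * (X - C (b : E)) * (X - C (c (a : E))⁻¹) := by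
    apply Polynomial.map_injective _ (AdeleRing.algebraMap_injective (𝓞 E) E)
    have hci : ((adelicVal F E c 3 _ ((δ * γ * δ⁻¹ : (quasiSplit F E c 3).arithmeticSubgroup) :
        (quasiSplit F E c 3).Adelic) : GL (Fin 3) (AdeleRing (𝓞 E) E)) : Matrix (Fin 3) (Fin 3) (AdeleRing (𝓞 E) E)).charpoly =
        ((adelicVal F E c 3 _ (γ : (quasiSplit F E c 3).Adelic) : GL (Fin 3) (AdeleRing (𝓞 E) E)) :
          Matrix (Fin 3) (Fin 3) (AdeleRing (𝓞 E) E)).charpoly :=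
      isConjInvariant_charpoly_adelicVal γ δ
    rw [← charpoly_adelicVal_toAdelic, hβ₀, hci, hγ]
  obtain ⟨u, -, hu⟩ := exists_unipotent_conj_eq_or_of_hyperbolic hc ha hb hB hp
  -- the rational element `r` with `r β₀ r⁻¹ = γ₀`: `u` or `w⁻¹ u`
  obtain ⟨r, hr⟩ : ∃ r : (quasiSplit F E c 3).Rational, r * β₀ * r⁻¹ = g₀ := by
    rcases hu with hu | hu
    · refine ⟨u, ?_⟩
      apply Subtype.ext; apply Units.ext; rw [hu, hg₀]
    · refine ⟨w⁻¹ * u, ?_⟩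
      -- `w⁻¹ (u β₀ u⁻¹) w = w⁻¹ (w γ₀ w⁻¹) w = γ₀`
      have hwg := coe_weyl_conj_diagonal hw hg₀
      have e1 : u * β₀ * u⁻¹ = w * g₀ * w⁻¹ := by
        apply Subtype.ext; apply Units.ext; rw [hu, hwg]
      have e2 : w⁻¹ * u * β₀ * (w⁻¹ * u)⁻¹ = w⁻¹ * (u * β₀ * u⁻¹) * w := by group
      rw [e2, e1]; group
  refine ⟨⟨(quasiSplit F E c 3).toAdelic r, r, rfl⟩ * δ, ?_⟩
  apply Subtype.ext
  have e3 : ((⟨(quasiSplit F E c 3).toAdelic r, r, rfl⟩ * δ * γ * (⟨(quasiSplit F E c 3).toAdelic r, r, rfl⟩ * δ)⁻¹ :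
      (quasiSplit F E c 3).arithmeticSubgroup) : (quasiSplit F E c 3).Adelic) =
      (quasiSplit F E c 3).toAdelic r * ((δ * γ * δ⁻¹ : (quasiSplit F E c 3).arithmeticSubgroup) :
        (quasiSplit F E c 3).Adelic) * ((quasiSplit F E c 3).toAdelic r)⁻¹ := by
    simp only [Subgroup.coe_mul, Subgroup.coe_inv, _root_.mul_inv_rev, mul_assoc]
  rw [e3, ← hβ₀, ← map_inv, ← map_mul, ← map_mul, hr]

end OneClass

end UnitaryGroup

end Literature.NumberTheory.Automorphic
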